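import Literature.Combinatorics.AssociationSchemes.MatchingLevelInequality
import Literature.Combinatorics.AssociationSchemes.SliceLevelInequality
import Literature.Combinatorics.AssociationSchemes.BiasedBonami
import HarnessLib

/-!
# Johnson harmonics under the biased product measures: the centred-product representation and the exact `μ_p`-norm

SETTING. The ladder calculus of `Literature.Combinatorics.AssociationSchemes.JohnsonHarmonics`: a coefficient vector
`q : Finset (Fin n) → ℝ` which is harmonic of degree `j` (`IsHarmonic j q`: supported on `j`-sets and killed by the lowering
operator `down`) defines the multilinear polynomial `V ↦ zeta q V = Σ_{T ⊆ V} q_T` on the cube `{0,1}^n` (points = subsets `V`),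
whose restrictions to slices are the Johnson eigenfunctions. The tree has the norm of `zeta q` on every SLICE
(`JohnsonSpectrum.slice_sum_zeta_mul_zeta_eq` / `SliceLevelInequality.sum_powersetCard_zeta_sq`:
`Σ_{|U| = t} (zeta q U)² = (ff(n−2j, t−j)/(t−j)!)·⟪q,q⟫`) and on the UNIFORM cube (`SliceLevelInequality.sum_univ_zeta_sq`:
`Σ_V (zeta q V)² = 2^{n−2j}·⟪q,q⟫`). This module adds the `p`-BIASED cube for every real `p` (no restriction `0 ≤ p ≤ 1` is
needed — the identities are polynomial in `p`):

* §1 `biasedWeight p V = p^{|V|}(1−p)^{n−|V|}` and the centred monomials `Π_{i∈T} (𝟙[i∈V] − p)` as products over all coordinates;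
* §2 **`zeta_eq_sum_mul_prod_sub`** — for `q` harmonic of degree `j` and EVERY `p`:
  `zeta q V = Σ_T q_T · Π_{i∈T} (𝟙[i∈V] − p)`, i.e. a harmonic multilinear polynomial equals its own re-centring at any bias
  (expanding the product, the coefficient of `𝟙[S ⊆ V]` for `|S| < j` is a superset sum `Σ_{T ⊇ S, |T| = j} q_T`, which vanishes
  for harmonic `q` — the tree's `MatchingLevelInequality.sum_supersets_eq_zero_of_isHarmonic`). This is the `{0,1}`-cube form of
  «harmonic multilinear = elementary» [cite: FilmusMossel2019, Lemma 3.7 / Thm. 3.9 (arXiv p. 7)];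
* §3 `sum_biasedWeight_mul_prod_mul_prod` — orthogonality of the centred monomials under `μ_p = Bernoulli(p)^{⊗n}`, as the
  finite weighted sum: `Σ_V p^{|V|}(1−p)^{n−|V|} · Π_{i∈T}(𝟙[i∈V]−p) · Π_{i∈T'}(𝟙[i∈V]−p) = 𝟙[T = T']·(p(1−p))^{|T|}`
  (coordinatewise `p(1−p)^k + (1−p)(−p)^k = 1, 0, p(1−p)` for `k = 0, 1, 2`, assembled with `Finset.prod_add`);
* §4 **`sum_biasedWeight_mul_zeta_mul_zeta`** — for `q` harmonic of degree `j` and `q'` harmonic of any degree: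
  `Σ_V p^{|V|}(1−p)^{n−|V|} · zeta q V · zeta q' V = (p(1−p))^j · ⟪q, q'⟫`
  (when the degrees differ both sides vanish: `⟪q,q'⟫ = 0` by disjointness of supports); in particular
  `𝔼_{μ_p}[(zeta q)²] = (p(1−p))^j ⟪q,q⟫` (`sum_biasedWeight_mul_zeta_sq`) — [cite: FilmusMossel2019, Thm. 3.9 (arXiv p. 7)]
  («`𝔼_α[fg] = 0` for homogeneous harmonic `f, g` of different degrees, and `= C_{f,g}·𝔼_α[(x₁−x₂)²⋯(x_{2d−1}−x_{2d})²]` for every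
  exchangeable measure `α`») specialised to the exchangeable product measure `α = μ_p^{⊗n}` with the constant made explicit
  (`𝔼_{μ_p}[(x₁−x₂)²] = 2p(1−p)`, so `C_{f,g} = 2^{−d}⟪f,g⟫`); at `p = 1/2` it gives back the uniform-cube norm
  (`sum_zeta_sq_eq_of_half`, cf. the tree's `sum_univ_zeta_sq`);
* §5 `biased_norm_eq_mul_slice_norm` — the COMPARISON with the slice norm that a transfer argument at bias `p` needs:
  `Σ_V p^{|V|}(1−p)^{n−|V|}(zeta q V)² · ff(n−2j,t−j) = (p(1−p))^j·(t−j)! · Σ_{|U|=t}(zeta q U)²` (for `j ≤ t`, `t + j ≤ n`).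

§6–§8 (appended): **BONAMI'S LEMMA FOR THE HARMONIC LAYERS OF A SLICE `C([n],t)` AT EVERY `0 < t < n`**, by transfer from the
`t/n`-biased cube. The tree's slice level-`j` inequality (`SliceLevelInequality`) was obtained by transfer from the UNIFORM cube and
is quantitative only on balanced slices (`n ≤ 4t`, or `n ≤ 5t` in the wide form); even moments of the layers ON a slice were not
available. Here, with constants depending on `t` only through `max(p,1−p)/min(p,1−p)`, `p = t/n`:
* §6 `one_le_succ_mul_binomial_mode` — the binomial law `Bin(n, t/n)` is maximal at `t`: `1 ≤ (n+1)·C(n,t)·p^t(1−p)^{n−t}`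
  (the `t`-th of the `n+1` terms of `(p + (1−p))^n = 1` is the largest: the term ratios cross `1` at `t`)
  [cite: Feller1968, Ch. VI §3 Thm. 1 (central term)];
* §7 `mul_sum_slice_le_sum_biased` — restriction: for `F ≥ 0`, `p^t(1−p)^{n−t}·Σ_{|U|=t} F(U) ≤ Σ_V p^{|V|}(1−p)^{n−|V|}·F(V)`;
* §8 **`slice_bonami_layer`** — for `0 < t < n`, `q` harmonic of degree `j`, `r ≥ 1`, `p = t/n`,
  `K = (2r−1)·max(p,1−p)/min(p,1−p)`:   `Σ_{|U|=t} (zeta q U)^{2r} ≤ (n+1)·C(n,t)·K^{rj}·((p(1−p))^j ⟪q,q⟫)^r`,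
  from the biased Bonami lemma `BiasedBonami.biased_bonami_even_moment_univ` [cite: ODonnell2014, Thm. 10.21 / §9.1] (the layer IS
  the polynomial `P_q` at every bias, §2) and the exact `μ_p`-norm of §4; and the EXPECTATION form **`slice_bonami_layer_expect`**:
  `𝔼_{|U|=t}[(zeta q)^{2r}] ≤ (n+1)·K^{rj}·(Λ·𝔼_{|U|=t}[(zeta q)²])^r` with the transfer ratio
  `Λ = transferRatio n t j p = (p(1−p))^j·C(n,t)·(t−j)!/ff(n−2j,t−j) = 𝔼_{μ_p}[(zeta q)²]/𝔼_{|U|=t}[(zeta q)²]` (§5;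
  `= Π_{i<j} t(n−t)(n−2i)(n−2i−1)/(n²(t−i)(n−t−i)) ≤ 4^j` for `2j ≤ min(t, n−t)`), i.e.
  `‖zeta q‖_{L^{2r}(slice)} ≤ (n+1)^{1/2r}·(√(2r−1)·√(max/min)·Λ^{1/2j})^{j}·‖zeta q‖_{L²(slice)}`.
  The factor `n+1` is the price of conditioning the product measure on `|V| = t` (`p = t/n` makes `t` the mode); in level-`d`
  applications it enters as `(n+1)^{1/(2r)}` with `r ≍ log(1/μ)/d`, i.e. it replaces `log(1/μ)` by `log(1/μ) + O(log n)`.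

WHY (cell pnp-psdrank, summit PneNP, LIT-29 §2): level-`d` inequalities of Bonami quality on slices `C([n],t)` with `t/n`
bounded away from `1/2` — and, by fibration, on balanced multislices (the cut-pair side of «PairSNT₁», prover MEMO-16 §6(b) /
eng MEMO-15 §2.2) — come by transfer from the `p`-biased cube with `p = t/n` (where `P_{μ_p}(|V| = t) ≍ n^{−1/2}`, against
`2^{−Θ(n)}` under the uniform cube when `t/n ≠ 1/2`); the transfer constant is exactly the ratio in §5. Everything here is PROVED;
no facts, no instances/notation; standard axioms. Label: support / instrument (Boolean-function analysis on the slice).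
WHAT THIS IS NOT: not the multislice statement and not a level-`d` inequality by itself (combine §8 with Hölder over the layers as
in `SliceLevelInequality.slice_level_pow_le`); nothing about matchings, psd rank or P vs NP.

## References
* [FilmusMossel2019] Y. Filmus, E. Mossel, *Harmonicity and invariance on slices of the Boolean cube*, Probab. Theory
  Related Fields 175 (2019) 721–782, arXiv:1507.02713 (held text `paper:arxiv-1507.02713`, pp. 6–8 read first-hand): Def. 3.1
  (harmonic), Lemma 3.7 (harmonic multilinear ⇔ elementary), Thm. 3.9 (norms under exchangeable measures).
* [Filmus2016] Y. Filmus, *An orthogonal basis for functions over a slice of the Boolean hypercube*, Electron. J. Combin.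
  23(1) (2016) P1.23 — the harmonic degree decomposition used by `JohnsonHarmonics`.
* [ODonnell2014] R. O'Donnell, *Analysis of Boolean Functions*, CUP 2014: §8.4 (`p`-biased analysis), §9.1 (Bonami's lemma),
  Thm. 10.21 (hypercontractivity of general product spaces, `(2,q,ρ)` with `ρ² ≍ λ/q`, `λ = min(p, 1−p)`).
* [Feller1968] W. Feller, *An Introduction to Probability Theory and Its Applications* I, 3rd ed., Wiley 1968: Ch. VI §3 Thm. 1
  (the central term of the binomial distribution: `b(k;n,p)` increases for `k < m` and decreases for `k > m`, `(n+1)p−1 < m ≤ (n+1)p`).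
-/

noncomputable section

namespace Literature.Combinatorics.AssociationSchemes.JohnsonHarmonicsBiased

open Finset
open Literature.Combinatorics.AssociationSchemes.JohnsonHarmonics
open Literature.Combinatorics.AssociationSchemes.JohnsonSpectrum
open Literature.Combinatorics.AssociationSchemes.SliceLevelInequality
open Literature.Combinatorics.AssociationSchemes.MatchingLevelInequality (sum_supersets_eq_zero_of_isHarmonic)
open Literature.Combinatorics.AssociationSchemes.BiasedBonami (cmono biased_bonami_even_moment_univ)

variable {n : ℕ}

/-! ### §1 Biased weights and centred monomials as products over the coordinates -/

/-- The indicator of `i ∈ V` as a real number (`𝟙[i ∈ V]`, the `i`-th coordinate of the point `V` of the cube). [folklore] -/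
def ind (V : Finset (Fin n)) (i : Fin n) : ℝ := if i ∈ V then 1 else 0

/-- The weight of the point `V` of the cube `{0,1}^n` under the `p`-biased product measure `μ_p = Bernoulli(p)^{⊗n}`:
`p^{|V|} (1−p)^{n−|V|}`. [cite: ODonnell2014, §8.4 (p-biased analysis)] -/
def biasedWeight (p : ℝ) (V : Finset (Fin n)) : ℝ := p ^ V.card * (1 - p) ^ (n - V.card)

/-- `p^{|V|}(1−p)^{n−|V|} = Π_i (p if i ∈ V, 1−p otherwise)`: the `p`-biased measure is the product measure `π_p^{⊗n}`.
[cite: ODonnell2014, §8.4 (p-biased analysis, π_p^{⊗n})] -/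
theorem biasedWeight_eq_prod (p : ℝ) (V : Finset (Fin n)) :
    biasedWeight p V = ∏ i : Fin n, (if i ∈ V then p else 1 - p) := by
  rw [prod_ite, prod_const, prod_const, biasedWeight]
  have h1 : (univ.filter fun i : Fin n => i ∈ V) = V := by ext i; simp
  have h2 : (univ.filter fun i : Fin n => ¬ i ∈ V) = univ \ V := by ext i; simp
  rw [h1, h2, card_univ_sdiff, Fintype.card_fin]

/-- A centred monomial as a product over all coordinates: `Π_{i∈T} (𝟙[i∈V] − p) = Π_i (𝟙[i∈V] − p if i ∈ T, 1 otherwise)`.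
[folklore] -/
private theorem prod_sub_eq_prod_univ (T V : Finset (Fin n)) (p : ℝ) :
    ∏ i ∈ T, (ind V i - p) = ∏ i : Fin n, (if i ∈ T then ind V i - p else 1) := by
  rw [prod_ite, prod_const_one, mul_one]
  have h1 : (univ.filter fun i : Fin n => i ∈ T) = T := by ext i; simp
  rw [h1]

/-- Binomial expansion of a centred monomial: `Π_{i∈T} (𝟙[i∈V] − p) = Σ_{S ⊆ T} 𝟙[S ⊆ V] · (−p)^{|T|−|S|}`. [folklore] -/
private theorem prod_ind_sub_eq_sum (T V : Finset (Fin n)) (p : ℝ) :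
    ∏ i ∈ T, (ind V i - p) = ∑ S ∈ T.powerset, (if S ⊆ V then (1 : ℝ) else 0) * (-p) ^ (T.card - S.card) := by
  have h : ∀ i ∈ T, ind V i - p = ind V i + (-p) := fun i _ => by ring
  rw [prod_congr rfl h, prod_add]
  refine sum_congr rfl fun S hS => ?_
  have hST : S ⊆ T := mem_powerset.1 hS
  congr 1
  · unfold ind
    rw [prod_boole]
    by_cases hSV : S ⊆ V
    · rw [if_pos hSV, if_pos fun i hi => hSV hi]
    · rw [if_neg hSV, if_neg]
      exact fun h' => hSV fun i hi => h' i hi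
  · rw [prod_const, card_sdiff_of_subset hST]

/-! ### §2 A harmonic multilinear polynomial equals its re-centring at any bias -/

/-- For `q` harmonic of degree `j` and any set `S`: the superset sum `Σ_{T ⊇ S} q_T` equals `q_S` if `|S| = j` and `0`
otherwise (for `|S| < j` by harmonicity — the tree's `sum_supersets_eq_zero_of_isHarmonic` —, for `|S| > j` by homogeneity).
[cite: FilmusMossel2019, Lemma 3.7 (arXiv p. 7)] -/
theorem sum_supersets_eq_of_isHarmonic {j : ℕ} {q : Finset (Fin n) → ℝ} (hq : IsHarmonic j q) (S : Finset (Fin n)) :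
    ∑ T ∈ univ.filter (fun T => S ⊆ T), q T = if S.card = j then q S else 0 := by
  -- only `j`-sets contribute
  have hres : ∑ T ∈ univ.filter (fun T => S ⊆ T), q T =
      ∑ T ∈ (univ.powersetCard j).filter (fun T => S ⊆ T), q T := by
    symm
    refine sum_subset ?_ ?_
    · intro T hT
      exact mem_filter.2 ⟨mem_univ T, (mem_filter.1 hT).2⟩
    · intro T hT hT'
      have hST : S ⊆ T := (mem_filter.1 hT).2
      refine hq.1 T fun h => hT' ?_
      exact mem_filter.2 ⟨mem_powersetCard.2 ⟨subset_univ T, h⟩, hST⟩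
  rw [hres]
  by_cases hS : S.card = j
  · rw [if_pos hS]
    have hset : (univ.powersetCard j).filter (fun T => S ⊆ T) = {S} := by
      ext T
      simp only [mem_filter, mem_powersetCard, subset_univ, true_and, mem_singleton]
      constructor
      · rintro ⟨hTj, hST⟩
        exact (eq_of_subset_of_card_le hST (by rw [hTj, hS])).symm
      · rintro rfl
        exact ⟨hS, Subset.rfl⟩
    rw [hset, sum_singleton]
  · rw [if_neg hS]
    rcases Nat.lt_or_gt_of_ne hS with hlt | hgt
    · obtain ⟨m, hm⟩ : ∃ m, S.card + (m + 1) = j := ⟨j - S.card - 1, by omega⟩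
      exact sum_supersets_eq_zero_of_isHarmonic hq m S hm
    · refine sum_eq_zero fun T hT => ?_
      simp only [mem_filter, mem_powersetCard, subset_univ, true_and] at hT
      have := card_le_card hT.2
      omega

/-- **Re-centring at any bias.** For `q` harmonic of degree `j`, every real `p` and every point `V` of the cube:
`zeta q V = Σ_T q_T · Π_{i∈T} (𝟙[i∈V] − p)`. [cite: FilmusMossel2019, Lemma 3.7 / Thm. 3.9 (arXiv p. 7)] -/
theorem zeta_eq_sum_mul_prod_sub {j : ℕ} {q : Finset (Fin n) → ℝ} (hq : IsHarmonic j q) (p : ℝ) (V : Finset (Fin n)) :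
    zeta q V = ∑ T : Finset (Fin n), q T * ∏ i ∈ T, (ind V i - p) := by
  -- expand every product and swap the sums
  have h1 : ∑ T : Finset (Fin n), q T * ∏ i ∈ T, (ind V i - p) =
      ∑ T : Finset (Fin n), ∑ S ∈ T.powerset, q T * ((if S ⊆ V then (1 : ℝ) else 0) * (-p) ^ (T.card - S.card)) := by
    refine sum_congr rfl fun T _ => ?_
    rw [prod_ind_sub_eq_sum, mul_sum]
  have h2 : ∑ T : Finset (Fin n), ∑ S ∈ T.powerset, q T * ((if S ⊆ V then (1 : ℝ) else 0) * (-p) ^ (T.card - S.card)) =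
      ∑ S : Finset (Fin n), ∑ T ∈ univ.filter (fun T => S ⊆ T),
        q T * ((if S ⊆ V then (1 : ℝ) else 0) * (-p) ^ (T.card - S.card)) := by
    refine sum_comm' fun T S => ?_
    simp only [mem_univ, mem_powerset, true_and, mem_filter, and_true]
  rw [h1, h2]
  -- for each `S` the inner sum is `𝟙[S ⊆ V]·𝟙[|S| = j]·q_S`
  have h3 : ∀ S : Finset (Fin n), ∑ T ∈ univ.filter (fun T => S ⊆ T),
      q T * ((if S ⊆ V then (1 : ℝ) else 0) * (-p) ^ (T.card - S.card)) =
        (if S ⊆ V then (1 : ℝ) else 0) * (if S.card = j then q S else 0) := by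
    intro S
    -- only `j`-sets `T` contribute, and for them the power of `−p` is the constant `(−p)^{j − |S|}`
    have hj : ∀ T ∈ univ.filter (fun T => S ⊆ T),
        q T * ((if S ⊆ V then (1 : ℝ) else 0) * (-p) ^ (T.card - S.card)) =
          ((if S ⊆ V then (1 : ℝ) else 0) * (-p) ^ (j - S.card)) * q T := by
      intro T _
      by_cases hT : T.card = j
      · rw [hT]; ring
      · rw [hq.1 T hT]; ring
    rw [sum_congr rfl hj, ← mul_sum, sum_supersets_eq_of_isHarmonic hq S]
    by_cases hS : S.card = j
    · rw [if_pos hS, hS, Nat.sub_self, pow_zero, mul_one]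
    · rw [if_neg hS, mul_zero, mul_zero]
  rw [sum_congr rfl fun S _ => h3 S]
  -- and `Σ_{S ⊆ V, |S| = j} q_S = zeta q V` by homogeneity
  rw [zeta_apply]
  have h4 : ∑ T ∈ V.powerset, q T = ∑ S : Finset (Fin n), if S ⊆ V then q S else 0 := by
    rw [← sum_filter]
    refine sum_congr ?_ fun _ _ => rfl
    ext S; simp
  rw [h4]
  refine sum_congr rfl fun S _ => ?_
  by_cases hSV : S ⊆ V
  · rw [if_pos hSV, if_pos hSV, one_mul]
    by_cases hS : S.card = j
    · rw [if_pos hS]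
    · rw [if_neg hS, hq.1 S hS]
  · rw [if_neg hSV, if_neg hSV, zero_mul]

/-! ### §3 Orthogonality of the centred monomials under `μ_p` -/

/-- The exponent pattern of a pair of monomials at a coordinate: `k_i = 𝟙[i∈T] + 𝟙[i∈T']`. [folklore] -/
private def expo (T T' : Finset (Fin n)) (i : Fin n) : ℕ := (if i ∈ T then 1 else 0) + (if i ∈ T' then 1 else 0)

/-- Coordinatewise form of the weighted pair product: for every `V`,
`p^{|V|}(1−p)^{n−|V|}·Π_{i∈T}(𝟙[i∈V]−p)·Π_{i∈T'}(𝟙[i∈V]−p) = Π_{i∈V} p(1−p)^{k_i} · Π_{i∉V} (1−p)(−p)^{k_i}`. [folklore] -/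
private theorem weight_mul_prod_mul_prod_eq (T T' V : Finset (Fin n)) (p : ℝ) :
    biasedWeight p V * ((∏ i ∈ T, (ind V i - p)) * ∏ i ∈ T', (ind V i - p)) =
      (∏ i ∈ V, p * (1 - p) ^ expo T T' i) * ∏ i ∈ univ \ V, (1 - p) * (-p) ^ expo T T' i := by
  rw [biasedWeight_eq_prod, prod_sub_eq_prod_univ, prod_sub_eq_prod_univ, ← prod_mul_distrib, ← prod_mul_distrib]
  have hR : (∏ i ∈ V, p * (1 - p) ^ expo T T' i) * ∏ i ∈ univ \ V, (1 - p) * (-p) ^ expo T T' i =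
      ∏ i : Fin n, (if i ∈ V then p * (1 - p) ^ expo T T' i else (1 - p) * (-p) ^ expo T T' i) := by
    rw [prod_ite]
    have h1 : (univ.filter fun i : Fin n => i ∈ V) = V := by ext i; simp
    have h2 : (univ.filter fun i : Fin n => ¬ i ∈ V) = univ \ V := by ext i; simp
    rw [h1, h2]
  rw [hR]
  refine prod_congr rfl fun i _ => ?_
  by_cases hV : i ∈ V <;> by_cases hT : i ∈ T <;> by_cases hT' : i ∈ T' <;>
    simp only [ind, expo, hV, hT, hT', ↓reduceIte] <;> ring

/-- The coordinate sums: `p(1−p)^k + (1−p)(−p)^k` is `1`, `0`, `p(1−p)` for `k = 0, 1, 2`. [folklore] -/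
private theorem coord_sum_eq (T T' : Finset (Fin n)) (p : ℝ) (i : Fin n) :
    p * (1 - p) ^ expo T T' i + (1 - p) * (-p) ^ expo T T' i =
      if i ∈ T then (if i ∈ T' then p * (1 - p) else 0) else (if i ∈ T' then 0 else 1) := by
  by_cases hT : i ∈ T <;> by_cases hT' : i ∈ T' <;> simp only [expo, hT, hT', ↓reduceIte] <;> ring

/-- **Orthogonality of the centred monomials under the `p`-biased measure**:
`Σ_V p^{|V|}(1−p)^{n−|V|} · Π_{i∈T}(𝟙[i∈V]−p) · Π_{i∈T'}(𝟙[i∈V]−p) = 𝟙[T = T']·(p(1−p))^{|T|}`.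
[cite: ODonnell2014, §8.4 (the φ-basis of the p-biased cube); FilmusMossel2019, Thm. 3.9] -/
theorem sum_biasedWeight_mul_prod_mul_prod (T T' : Finset (Fin n)) (p : ℝ) :
    ∑ V : Finset (Fin n), biasedWeight p V * ((∏ i ∈ T, (ind V i - p)) * ∏ i ∈ T', (ind V i - p)) =
      if T = T' then (p * (1 - p)) ^ T.card else 0 := by
  rw [sum_congr rfl fun V _ => weight_mul_prod_mul_prod_eq T T' V p]
  -- `Σ_{V ⊆ [n]} Π_{i∈V} f_i Π_{i∉V} g_i = Π_i (f_i + g_i)`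
  have h := (prod_add (fun i : Fin n => p * (1 - p) ^ expo T T' i) (fun i => (1 - p) * (-p) ^ expo T T' i) univ).symm
  rw [powerset_univ] at h
  rw [h, prod_congr rfl fun i _ => coord_sum_eq T T' p i]
  by_cases hTT : T = T'
  · subst hTT
    rw [if_pos rfl]
    have h2 : ∀ i ∈ (univ : Finset (Fin n)),
        (if i ∈ T then (if i ∈ T then p * (1 - p) else 0) else (if i ∈ T then (0 : ℝ) else 1)) =
          if i ∈ T then p * (1 - p) else 1 := by
      intro i _
      by_cases hT : i ∈ T
      · rw [if_pos hT, if_pos hT, if_pos hT]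
      · rw [if_neg hT, if_neg hT, if_neg hT]
    rw [prod_congr rfl h2, prod_ite, prod_const, prod_const_one, mul_one]
    have h1 : (univ.filter fun i : Fin n => i ∈ T) = T := by ext i; simp
    rw [h1]
  · rw [if_neg hTT]
    -- some coordinate lies in exactly one of `T`, `T'`, where the factor vanishes
    have hex : ∃ i, (i ∈ T ∧ i ∉ T') ∨ (i ∉ T ∧ i ∈ T') := by
      by_contra hne
      apply hTT
      ext i
      constructor
      · intro hi
        by_contra hi'
        exact hne ⟨i, Or.inl ⟨hi, hi'⟩⟩
      · intro hi'
        by_contra hi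
        exact hne ⟨i, Or.inr ⟨hi, hi'⟩⟩
    obtain ⟨i, hi⟩ := hex
    refine prod_eq_zero (mem_univ i) ?_
    rcases hi with ⟨hT, hT'⟩ | ⟨hT, hT'⟩
    · rw [if_pos hT, if_neg hT']
    · rw [if_neg hT, if_pos hT']

/-! ### §4 The exact `μ_p`-norm (and cross-norm) of `zeta` of harmonic vectors -/

/-- **Filmus–Mossel Theorem 3.9 for the `p`-biased cube, explicit constant.** For `q` harmonic of degree `j`, `q'` harmonic
of any degree `j'`, and every real `p`:
`Σ_V p^{|V|}(1−p)^{n−|V|} · zeta q V · zeta q' V = (p(1−p))^j · ⟪q, q'⟫`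
(for `j ≠ j'` both sides are `0`, the coefficient inner product `⟪q,q'⟫ = Σ_S q_S q'_S` having disjointly supported factors).
[cite: FilmusMossel2019, Thm. 3.9 (arXiv p. 7)] -/
theorem sum_biasedWeight_mul_zeta_mul_zeta {j j' : ℕ} {q q' : Finset (Fin n) → ℝ} (hq : IsHarmonic j q)
    (hq' : IsHarmonic j' q') (p : ℝ) :
    ∑ V : Finset (Fin n), biasedWeight p V * (zeta q V * zeta q' V) = (p * (1 - p)) ^ j * ip q q' := by
  -- expand both `zeta`'s as centred sums and exchange the order of summation
  have h1 : ∀ V : Finset (Fin n), biasedWeight p V * (zeta q V * zeta q' V) =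
      ∑ T : Finset (Fin n), ∑ T' : Finset (Fin n),
        q T * q' T' * (biasedWeight p V * ((∏ i ∈ T, (ind V i - p)) * ∏ i ∈ T', (ind V i - p))) := by
    intro V
    rw [zeta_eq_sum_mul_prod_sub hq p V, zeta_eq_sum_mul_prod_sub hq' p V, sum_mul_sum, mul_sum]
    refine sum_congr rfl fun T _ => ?_
    rw [mul_sum]
    refine sum_congr rfl fun T' _ => ?_
    ring
  rw [sum_congr rfl fun V _ => h1 V, sum_comm]
  rw [sum_congr rfl fun T _ => sum_comm]
  simp_rw [← mul_sum, sum_biasedWeight_mul_prod_mul_prod]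
  -- diagonal terms only
  have h2 : ∀ T : Finset (Fin n), ∑ T' : Finset (Fin n), q T * q' T' * (if T = T' then (p * (1 - p)) ^ T.card else 0) =
      q T * q' T * (p * (1 - p)) ^ T.card := by
    intro T
    rw [sum_eq_single T]
    · rw [if_pos rfl]
    · intro T' _ hT'
      rw [if_neg (Ne.symm hT'), mul_zero]
    · intro h; exact absurd (mem_univ T) h
  rw [sum_congr rfl fun T _ => h2 T]
  unfold ip
  rw [mul_sum]
  refine sum_congr rfl fun T _ => ?_
  by_cases hT : T.card = j
  · rw [hT]; ring
  · rw [hq.1 T hT]; ring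

/-- The `μ_p`-norm: `Σ_V p^{|V|}(1−p)^{n−|V|} (zeta q V)² = (p(1−p))^j ⟪q,q⟫` for `q` harmonic of degree `j`.
[cite: FilmusMossel2019, Thm. 3.9 (arXiv p. 7)] -/
theorem sum_biasedWeight_mul_zeta_sq {j : ℕ} {q : Finset (Fin n) → ℝ} (hq : IsHarmonic j q) (p : ℝ) :
    ∑ V : Finset (Fin n), biasedWeight p V * zeta q V ^ 2 = (p * (1 - p)) ^ j * ip q q := by
  rw [← sum_biasedWeight_mul_zeta_mul_zeta hq hq p]
  exact sum_congr rfl fun V _ => by rw [sq]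

/-- Harmonic layers of different degrees are `μ_p`-orthogonal for every `p`. [cite: FilmusMossel2019, Thm. 3.9 (arXiv p. 7)] -/
theorem sum_biasedWeight_mul_zeta_mul_zeta_eq_zero {j j' : ℕ} (hjj : j ≠ j') {q q' : Finset (Fin n) → ℝ}
    (hq : IsHarmonic j q) (hq' : IsHarmonic j' q') (p : ℝ) :
    ∑ V : Finset (Fin n), biasedWeight p V * (zeta q V * zeta q' V) = 0 := by
  rw [sum_biasedWeight_mul_zeta_mul_zeta hq hq' p]
  have h : ip q q' = 0 := by
    unfold ip
    refine sum_eq_zero fun S _ => ?_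
    by_cases hS : S.card = j
    · rw [hq'.1 S (by rw [hS]; exact hjj), mul_zero]
    · rw [hq.1 S hS, zero_mul]
  rw [h, mul_zero]

/-- At `p = 1/2` the biased weights are the uniform ones, `2^{−n}`: the `μ_{1/2}`-norm identity reads
`Σ_V (zeta q V)² = 2^n · 4^{−j} · ⟪q,q⟫ = 2^{n−2j}⟪q,q⟫` (cf. the tree's `sum_univ_zeta_sq`).
[cite: FilmusMossel2019, Thm. 3.9 (arXiv p. 7), uniform measure] -/
theorem sum_zeta_sq_eq_of_half {j : ℕ} {q : Finset (Fin n) → ℝ} (hq : IsHarmonic j q) :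
    ∑ V : Finset (Fin n), zeta q V ^ 2 = 2 ^ n * (1 / 4 : ℝ) ^ j * ip q q := by
  have hw : ∀ V : Finset (Fin n), biasedWeight (1 / 2 : ℝ) V = (1 / 2) ^ n := by
    intro V
    rw [biasedWeight, show (1 : ℝ) - 1 / 2 = 1 / 2 by norm_num, ← pow_add]
    have : V.card ≤ n := by simpa using card_le_univ V
    rw [Nat.add_sub_cancel' this]
  have h := sum_biasedWeight_mul_zeta_sq hq (1 / 2 : ℝ)
  rw [sum_congr rfl fun V _ => by rw [hw V], ← mul_sum, show (1 / 2 : ℝ) * (1 - 1 / 2) = 1 / 4 by norm_num] at h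
  have h2 : (2 : ℝ) ^ n * (1 / 2 : ℝ) ^ n = 1 := by rw [← mul_pow]; norm_num
  calc ∑ V : Finset (Fin n), zeta q V ^ 2 = 2 ^ n * ((1 / 2 : ℝ) ^ n * ∑ V : Finset (Fin n), zeta q V ^ 2) := by
        rw [← mul_assoc, h2, one_mul]
    _ = 2 ^ n * (1 / 4 : ℝ) ^ j * ip q q := by rw [h, mul_assoc]

/-! ### §5 Comparison with the slice norm -/

/-- **Biased-cube norm versus slice norm.** For `q` harmonic of degree `j ≤ t` with `t + j ≤ n` and every real `p`:
`(Σ_V p^{|V|}(1−p)^{n−|V|} (zeta q V)²) · ff(n−2j, t−j) = (p(1−p))^j · (t−j)! · Σ_{|U|=t} (zeta q U)²`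
— the two quadratic forms are proportional on each harmonic degree, with the ratio `(p(1−p))^j (t−j)!/ff(n−2j,t−j)`
(`= (p(1−p))^j / C(n−2j, t−j)`). [cite: FilmusMossel2019, Thm. 3.9 (arXiv p. 7)] [cite: Filmus2016, Thm. 4.1] -/
theorem biased_norm_eq_mul_slice_norm {j t : ℕ} (hjt : j ≤ t) {q : Finset (Fin n) → ℝ}
    (hq : IsHarmonic j q) (p : ℝ) :
    (∑ V : Finset (Fin n), biasedWeight p V * zeta q V ^ 2) * ff ((n : ℝ) - 2 * j) (t - j) =
      (p * (1 - p)) ^ j * (t - j).factorial * ∑ U ∈ univ.powersetCard t, zeta q U ^ 2 := by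
  rw [sum_biasedWeight_mul_zeta_sq hq p, sum_powersetCard_zeta_sq hjt hq]
  have hf : ((t - j).factorial : ℝ) ≠ 0 := by exact_mod_cast (Nat.factorial_pos _).ne'
  field_simp

/-! ### §6 The binomial law `Bin(n, t/n)` is maximal at `t` (the slice transfer, LIT-29 §2) -/

/-- The binomial weights `T_k = C(n,k) p^k (1−p)^{n−k}`. [folklore] -/
private def binTerm (n : ℕ) (p : ℝ) (k : ℕ) : ℝ := (n.choose k : ℝ) * p ^ k * (1 - p) ^ (n - k)

/-- `Σ_{k ≤ n} C(n,k) p^k (1−p)^{n−k} = 1`. [folklore] -/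
private theorem sum_binTerm (n : ℕ) (p : ℝ) : ∑ k ∈ range (n + 1), binTerm n p k = 1 := by
  have h := add_pow p (1 - p) n
  rw [show p + (1 - p) = 1 by ring, one_pow] at h
  rw [h]
  exact sum_congr rfl fun k _ => by unfold binTerm; ring

/-- Nonnegativity of the binomial weights for `0 ≤ p ≤ 1`. [folklore] -/
private theorem binTerm_nonneg (n : ℕ) {p : ℝ} (hp0 : 0 ≤ p) (hp1 : p ≤ 1) (k : ℕ) : 0 ≤ binTerm n p k := by
  unfold binTerm
  have : 0 ≤ 1 - p := by linarith
  positivity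

/-- The ratio identity `T_{k+1}·(k+1)(1−p) = T_k·(n−k)p` (`k + 1 ≤ n`). [folklore] -/
private theorem binTerm_succ_mul (n : ℕ) (p : ℝ) {k : ℕ} (hk : k + 1 ≤ n) :
    binTerm n p (k + 1) * ((k + 1 : ℝ) * (1 - p)) = binTerm n p k * ((n - k : ℝ) * p) := by
  unfold binTerm
  have hc : ((n.choose (k + 1) : ℕ) : ℝ) * (k + 1) = (n.choose k : ℝ) * (n - k : ℝ) := by
    have h := Nat.choose_succ_right_eq n k
    have hsub : ((n - k : ℕ) : ℝ) = (n : ℝ) - k := by rw [Nat.cast_sub (by omega)]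
    rw [← hsub]; exact_mod_cast h
  have he : n - k = (n - (k + 1)) + 1 := by omega
  rw [he, pow_succ, pow_succ]
  calc (n.choose (k + 1) : ℝ) * (p ^ k * p) * (1 - p) ^ (n - (k + 1)) * ((k + 1 : ℝ) * (1 - p))
      = ((n.choose (k + 1) : ℝ) * (k + 1)) * (p ^ k * p * (1 - p) ^ (n - (k + 1)) * (1 - p)) := by ring
    _ = ((n.choose k : ℝ) * (n - k : ℝ)) * (p ^ k * p * (1 - p) ^ (n - (k + 1)) * (1 - p)) := by rw [hc]
    _ = (n.choose k : ℝ) * p ^ k * ((1 - p) ^ (n - (k + 1)) * (1 - p)) * ((n - k : ℝ) * p) := by ring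

/-- Below `t` the weights of `Bin(n, t/n)` increase: `T_k ≤ T_{k+1}` for `k + 1 ≤ t < n`. [folklore] -/
private theorem binTerm_le_succ {t k : ℕ} (htn : t < n) (hk : k + 1 ≤ t) :
    binTerm n ((t : ℝ) / n) k ≤ binTerm n ((t : ℝ) / n) (k + 1) := by
  set p : ℝ := (t : ℝ) / n with hp
  have hn' : (0 : ℝ) < n := by exact_mod_cast (lt_of_le_of_lt (Nat.zero_le t) htn)
  have ht' : (t : ℝ) < n := by exact_mod_cast htn
  have hp0 : 0 ≤ p := by positivity
  have hp1 : p < 1 := by rw [hp, div_lt_one hn']; exact ht'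
  have hT0 : 0 ≤ binTerm n p k := binTerm_nonneg n hp0 hp1.le k
  have hid := binTerm_succ_mul n p (show k + 1 ≤ n by omega)
  have ha : 0 < (k + 1 : ℝ) * (1 - p) := by
    have : 0 < 1 - p := by linarith
    positivity
  -- `(k+1)(1−p) ≤ (n−k)p` for `p = t/n`, `k + 1 ≤ t`
  have hcoef : (k + 1 : ℝ) * (1 - p) ≤ (n - k : ℝ) * p := by
    have hk' : (k : ℝ) + 1 ≤ t := by exact_mod_cast hk
    have h1 : (k + 1 : ℝ) * (1 - p) * n = (k + 1) * (n - t) := by rw [hp]; field_simp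
    have h2 : (n - k : ℝ) * p * n = (n - k) * t := by rw [hp]; field_simp
    have key : (k + 1 : ℝ) * (n - t) ≤ (n - k) * t := by nlinarith
    nlinarith
  have h1 : binTerm n p k * ((k + 1 : ℝ) * (1 - p)) ≤ binTerm n p (k + 1) * ((k + 1 : ℝ) * (1 - p)) := by
    rw [hid]; exact mul_le_mul_of_nonneg_left hcoef hT0
  exact le_of_mul_le_mul_right h1 ha

/-- Above `t` the weights of `Bin(n, t/n)` decrease: `T_{k+1} ≤ T_k` for `t ≤ k`, `k + 1 ≤ n`. [folklore] -/
private theorem binTerm_succ_le {t k : ℕ} (htn : t < n) (htk : t ≤ k) (hk : k + 1 ≤ n) :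
    binTerm n ((t : ℝ) / n) (k + 1) ≤ binTerm n ((t : ℝ) / n) k := by
  set p : ℝ := (t : ℝ) / n with hp
  have hn' : (0 : ℝ) < n := by exact_mod_cast (lt_of_le_of_lt (Nat.zero_le t) htn)
  have ht' : (t : ℝ) < n := by exact_mod_cast htn
  have hp0 : 0 ≤ p := by positivity
  have hp1 : p < 1 := by rw [hp, div_lt_one hn']; exact ht'
  have hT0 : 0 ≤ binTerm n p (k + 1) := binTerm_nonneg n hp0 hp1.le (k + 1)
  have hid := binTerm_succ_mul n p hk
  have ha : 0 < (k + 1 : ℝ) * (1 - p) := by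
    have : 0 < 1 - p := by linarith
    positivity
  -- `(n−k)p ≤ (k+1)(1−p)` for `p = t/n`, `t ≤ k`
  have hcoef : (n - k : ℝ) * p ≤ (k + 1 : ℝ) * (1 - p) := by
    have hk' : (t : ℝ) ≤ k := by exact_mod_cast htk
    have hkn : (k : ℝ) + 1 ≤ n := by exact_mod_cast hk
    have h1 : (k + 1 : ℝ) * (1 - p) * n = (k + 1) * (n - t) := by rw [hp]; field_simp
    have h2 : (n - k : ℝ) * p * n = (n - k) * t := by rw [hp]; field_simp
    have key : (n - k : ℝ) * t ≤ (k + 1) * (n - t) := by nlinarith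
    nlinarith
  have h1 : binTerm n p (k + 1) * ((k + 1 : ℝ) * (1 - p)) ≤ binTerm n p k * ((k + 1 : ℝ) * (1 - p)) := by
    rw [hid]
    exact mul_le_mul_of_nonneg_left hcoef (binTerm_nonneg n hp0 hp1.le k)
  exact le_of_mul_le_mul_right h1 ha

/-- Every weight of `Bin(n, t/n)` is at most the weight at `t` (`0 ≤ k ≤ n`, `t < n`). [folklore] -/
private theorem binTerm_le_mode {t : ℕ} (htn : t < n) {k : ℕ} (hkn : k ≤ n) :
    binTerm n ((t : ℝ) / n) k ≤ binTerm n ((t : ℝ) / n) t := by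
  rcases le_or_gt k t with hkt | htk
  · -- climb from `k` to `t`
    have climb : ∀ i : ℕ, i ≤ t → binTerm n ((t : ℝ) / n) (t - i) ≤ binTerm n ((t : ℝ) / n) t := by
      intro i
      induction i with
      | zero => intro _; rw [Nat.sub_zero]
      | succ i ih =>
        intro hi
        have h1 := binTerm_le_succ (k := t - (i + 1)) htn (by omega)
        rw [show t - (i + 1) + 1 = t - i by omega] at h1
        exact h1.trans (ih (by omega))
    have := climb (t - k) (by omega)
    rwa [show t - (t - k) = k by omega] at this
  · -- descend from `t` to `k`
    have descend : ∀ m : ℕ, t ≤ m → m ≤ n → binTerm n ((t : ℝ) / n) m ≤ binTerm n ((t : ℝ) / n) t := by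
      intro m htm hmn
      induction m, htm using Nat.le_induction with
      | base => exact le_rfl
      | succ m htm ih => exact (binTerm_succ_le htn htm hmn).trans (ih (by omega))
    exact descend k htk.le hkn

/-- **The central term of the binomial law.** For `t < n` and `p = t/n` the `t`-th term of `(p + (1−p))^n` is the largest,
whence `1 ≤ (n+1)·C(n,t)·p^t(1−p)^{n−t}`.
[cite: Feller1968, Ch. VI §3 Thm. 1 (the terms `b(k;n,p)` increase up to the central term `m`, `(n+1)p − 1 < m ≤ (n+1)p`, then decrease)] -/
theorem one_le_succ_mul_binomial_mode {t : ℕ} (htn : t < n) :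
    (1 : ℝ) ≤ (n + 1 : ℝ) * ((n.choose t : ℝ) * ((t : ℝ) / n) ^ t * (1 - (t : ℝ) / n) ^ (n - t)) := by
  have hsum := sum_binTerm n ((t : ℝ) / n)
  have hle : ∑ k ∈ range (n + 1), binTerm n ((t : ℝ) / n) k ≤ ∑ _k ∈ range (n + 1), binTerm n ((t : ℝ) / n) t :=
    sum_le_sum fun k hk => binTerm_le_mode htn (Nat.lt_succ_iff.1 (mem_range.1 hk))
  rw [hsum, sum_const, card_range, nsmul_eq_mul] at hle
  unfold binTerm at hle
  exact_mod_cast hle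

/-! ### §7 Restricting the biased cube to the slice -/

/-- **Restriction to the slice.** For `F ≥ 0` and `0 ≤ p ≤ 1`:
`p^t(1−p)^{n−t}·Σ_{|U|=t} F(U) ≤ Σ_V p^{|V|}(1−p)^{n−|V|} F(V)` (drop the terms `|V| ≠ t` of the `p`-biased expectation).
[cite: ODonnell2014, §8.4 (the `p`-biased measure `π_p^{⊗n}`); elementary] -/
theorem mul_sum_slice_le_sum_biased (t : ℕ) {p : ℝ} (hp0 : 0 ≤ p) (hp1 : p ≤ 1) (F : Finset (Fin n) → ℝ)
    (hF : ∀ V, 0 ≤ F V) :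
    p ^ t * (1 - p) ^ (n - t) * ∑ U ∈ univ.powersetCard t, F U ≤ ∑ V : Finset (Fin n), biasedWeight p V * F V := by
  rw [mul_sum]
  have h1 : ∑ U ∈ univ.powersetCard t, p ^ t * (1 - p) ^ (n - t) * F U =
      ∑ U ∈ univ.powersetCard t, biasedWeight p U * F U := by
    refine sum_congr rfl fun U hU => ?_
    rw [biasedWeight, (mem_powersetCard.1 hU).2]
  rw [h1]
  refine sum_le_sum_of_subset_of_nonneg (subset_univ _) fun V _ _ => ?_
  have : 0 ≤ 1 - p := by linarith
  unfold biasedWeight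
  exact mul_nonneg (by positivity) (hF V)

/-! ### §8 Bonami for a harmonic layer on the slice -/

/-- A Johnson harmonic layer is the centred polynomial `P_q` of `BiasedBonami` at every bias. [cite: FilmusMossel2019, Thm. 3.9] -/
theorem cpoly_univ_eq_zeta {j : ℕ} {q : Finset (Fin n) → ℝ} (hq : IsHarmonic j q) (p : ℝ) (V : Finset (Fin n)) :
    ∑ T : Finset (Fin n), q T * cmono p T V = zeta q V := by
  rw [zeta_eq_sum_mul_prod_sub hq p V]
  rfl

/-- **Bonami's lemma for a harmonic layer on the slice `{|U| = t}`, every `0 < t < n`** (even moments, counting form):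
for `q` harmonic of degree `j`, `r ≥ 1`, `p = t/n` and `K = (2r−1)·max(p,1−p)/min(p,1−p)`,
`Σ_{|U|=t} (zeta q U)^{2r} ≤ (n+1)·C(n,t)·K^{rj}·((p(1−p))^j ⟪q,q⟫)^r`.
[cite: ODonnell2014, Thm. 10.21 (biased hypercontractivity; transferred to the slice)] -/
theorem slice_bonami_layer {t j : ℕ} (ht0 : 0 < t) (htn : t < n) {q : Finset (Fin n) → ℝ} (hq : IsHarmonic j q)
    (r : ℕ) (hr : 1 ≤ r) :
    ∑ U ∈ univ.powersetCard t, (zeta q U ^ 2) ^ r ≤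
      (n + 1 : ℝ) * (n.choose t : ℝ) *
        ((2 * r - 1 : ℝ) * (max ((t : ℝ) / n) (1 - (t : ℝ) / n) / min ((t : ℝ) / n) (1 - (t : ℝ) / n))) ^ (r * j) *
          ((((t : ℝ) / n) * (1 - (t : ℝ) / n)) ^ j * ip q q) ^ r := by
  set p : ℝ := (t : ℝ) / n with hp
  set K : ℝ := (2 * r - 1 : ℝ) * (max p (1 - p) / min p (1 - p)) with hK
  have hn' : (0 : ℝ) < n := by exact_mod_cast (lt_of_le_of_lt (Nat.zero_le t) htn)
  have hp0 : 0 < p := by rw [hp]; exact div_pos (by exact_mod_cast ht0) hn'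
  have hp1 : p < 1 := by rw [hp, div_lt_one hn']; exact_mod_cast htn
  -- biased Bonami for the polynomial `P_q`, which is the layer `zeta q`
  have hdeg : ∀ T : Finset (Fin n), j < T.card → q T = 0 := fun T hT => hq.1 T (by omega)
  have hB := biased_bonami_even_moment_univ hp0 hp1 r hr j q hdeg
  simp_rw [cpoly_univ_eq_zeta hq p] at hB
  -- the exact biased second moment
  have h2 : ∑ V : Finset (Fin n), p ^ V.card * (1 - p) ^ (n - V.card) * zeta q V ^ 2 = (p * (1 - p)) ^ j * ip q q :=
    sum_biasedWeight_mul_zeta_sq hq p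
  rw [h2] at hB
  -- restriction to the slice, and the mode bound
  have hrestr := mul_sum_slice_le_sum_biased t hp0.le hp1.le (fun V => (zeta q V ^ 2) ^ r) fun V => by positivity
  have hmode := one_le_succ_mul_binomial_mode (n := n) htn
  have hS0 : 0 ≤ ∑ U ∈ univ.powersetCard t, (zeta q U ^ 2) ^ r := sum_nonneg fun U _ => by positivity
  have hw0 : 0 ≤ p ^ t * (1 - p) ^ (n - t) := by
    have : 0 ≤ 1 - p := by linarith
    positivity
  have hKr0 : 0 ≤ K ^ (r * j) * ((p * (1 - p)) ^ j * ip q q) ^ r := by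
    have h := hB.trans' (sum_nonneg fun V _ => mul_nonneg
      (mul_nonneg (pow_nonneg hp0.le _) (pow_nonneg (by linarith) _)) (by positivity))
    exact h
  calc ∑ U ∈ univ.powersetCard t, (zeta q U ^ 2) ^ r
      = 1 * ∑ U ∈ univ.powersetCard t, (zeta q U ^ 2) ^ r := (one_mul _).symm
    _ ≤ ((n + 1 : ℝ) * ((n.choose t : ℝ) * p ^ t * (1 - p) ^ (n - t))) * ∑ U ∈ univ.powersetCard t, (zeta q U ^ 2) ^ r :=
        mul_le_mul_of_nonneg_right hmode hS0
    _ = (n + 1 : ℝ) * (n.choose t : ℝ) * (p ^ t * (1 - p) ^ (n - t) * ∑ U ∈ univ.powersetCard t, (zeta q U ^ 2) ^ r) := by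
        ring
    _ ≤ (n + 1 : ℝ) * (n.choose t : ℝ) * ∑ V : Finset (Fin n), biasedWeight p V * (zeta q V ^ 2) ^ r :=
        mul_le_mul_of_nonneg_left hrestr (by positivity)
    _ ≤ (n + 1 : ℝ) * (n.choose t : ℝ) * (K ^ (r * j) * ((p * (1 - p)) ^ j * ip q q) ^ r) :=
        mul_le_mul_of_nonneg_left hB (by positivity)
    _ = _ := by ring

/-- The transfer ratio between the `μ_{p}`-norm and the slice norm of a harmonic layer of degree `j`:
`Λ(n,t,j,p) = (p(1−p))^j · C(n,t) · (t−j)! / ff(n−2j, t−j)` (`= 𝔼_{μ_p}[(zeta q)²] / 𝔼_{|U|=t}[(zeta q)²]`; at `p = t/n`,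
`= Π_{i<j} t(n−t)(n−2i)(n−2i−1)/(n²(t−i)(n−t−i)) ≤ 4^j` for `2j ≤ min(t, n−t)`). [cite: FilmusMossel2019, Thm. 3.9] -/
def transferRatio (n t j : ℕ) (p : ℝ) : ℝ :=
  (p * (1 - p)) ^ j * (n.choose t : ℝ) * ((t - j).factorial : ℝ) / ff ((n : ℝ) - 2 * j) (t - j)

/-- **Bonami's lemma for a harmonic layer on the slice, expectation form.** For `0 < t < n`, `q` harmonic of degree `j ≤ t`
with `t + j ≤ n`, `r ≥ 1`, `p = t/n`, `K = (2r−1)·max(p,1−p)/min(p,1−p)` and `Λ = transferRatio n t j p`: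
`𝔼_{|U|=t}[(zeta q)^{2r}] ≤ (n+1)·K^{rj}·(Λ · 𝔼_{|U|=t}[(zeta q)²])^r` (expectations = sums divided by `C(n,t)`).
[cite: ODonnell2014, Thm. 10.21; FilmusMossel2019, Thm. 3.9] -/
theorem slice_bonami_layer_expect {t j : ℕ} (ht0 : 0 < t) (htn : t < n) (hjt : j ≤ t) (htj : t + j ≤ n)
    {q : Finset (Fin n) → ℝ} (hq : IsHarmonic j q) (r : ℕ) (hr : 1 ≤ r) :
    (∑ U ∈ univ.powersetCard t, (zeta q U ^ 2) ^ r) / (n.choose t : ℝ) ≤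
      (n + 1 : ℝ) *
        ((2 * r - 1 : ℝ) * (max ((t : ℝ) / n) (1 - (t : ℝ) / n) / min ((t : ℝ) / n) (1 - (t : ℝ) / n))) ^ (r * j) *
          (transferRatio n t j ((t : ℝ) / n) * ((∑ U ∈ univ.powersetCard t, zeta q U ^ 2) / (n.choose t : ℝ))) ^ r := by
  set p : ℝ := (t : ℝ) / n
  set K : ℝ := (2 * r - 1 : ℝ) * (max p (1 - p) / min p (1 - p))
  have hmain := slice_bonami_layer ht0 htn hq r hr
  have hC : (0 : ℝ) < (n.choose t : ℝ) := by exact_mod_cast Nat.choose_pos htn.le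
  have hff : 0 < ff ((n : ℝ) - 2 * j) (t - j) := ff_sub_pos hjt htj
  -- `(p(1−p))^j ⟪q,q⟫ = Λ · 𝔼_slice[(zeta q)²]`
  have hnorm := biased_norm_eq_mul_slice_norm (t := t) hjt hq p
  rw [sum_biasedWeight_mul_zeta_sq hq p] at hnorm
  have hX : (p * (1 - p)) ^ j * ip q q =
      transferRatio n t j p * ((∑ U ∈ univ.powersetCard t, zeta q U ^ 2) / (n.choose t : ℝ)) := by
    unfold transferRatio
    rw [show (p * (1 - p)) ^ j * (n.choose t : ℝ) * ((t - j).factorial : ℝ) / ff ((n : ℝ) - 2 * j) (t - j) *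
        ((∑ U ∈ univ.powersetCard t, zeta q U ^ 2) / (n.choose t : ℝ)) =
        ((p * (1 - p)) ^ j * ((t - j).factorial : ℝ) * ∑ U ∈ univ.powersetCard t, zeta q U ^ 2) /
          ff ((n : ℝ) - 2 * j) (t - j) * ((n.choose t : ℝ) / (n.choose t : ℝ)) by ring]
    rw [div_self hC.ne', mul_one, ← hnorm, mul_div_assoc, div_self hff.ne', mul_one]
  rw [← hX]
  rw [div_le_iff₀ hC]
  calc ∑ U ∈ univ.powersetCard t, (zeta q U ^ 2) ^ r
      ≤ (n + 1 : ℝ) * (n.choose t : ℝ) * K ^ (r * j) * ((p * (1 - p)) ^ j * ip q q) ^ r := hmain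
    _ = (n + 1 : ℝ) * K ^ (r * j) * ((p * (1 - p)) ^ j * ip q q) ^ r * (n.choose t : ℝ) := by ring

end Literature.Combinatorics.AssociationSchemes.JohnsonHarmonicsBiased
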